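import Literature.NumberTheory.LFunctions.WeilMarkovQuadratic
import Literature.NumberTheory.LFunctions.WeilOddGroundState
import HarnessLib

/-!
# Bilinear Markov vocabulary for the origin-layer line of `OddSector.OddOneSignedWindows`
(definitions for crux item stmt-RiemannHypothesis-17778, line `Sketch` = idea card
`log-coercive-origin-layer`; RH-free)

The Markov decomposition of Weil's quadratic functional
(`Literature.NumberTheory.LFunctions.weilQuadratic_re_eq_weilPoleForm_add_weilDirichletEnergy_sub`,
Bombieri 2000 Thm 2 read through increments: `Re Q(g) = P(g) + 𝓔_a(g) − M_a ‖g‖₂²`) is stated in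
the tree for the QUADRATIC forms `weilPoleForm`, `weilIncrement`, `weilDirichletEnergy`. The
origin-layer argument (an antisymmetric maximum principle of Jarohs–Weth type with the prime atoms
kept as an explicit defect) needs their POLAR (bilinear) forms, the two layer functionals
"prime defect" and "archimedean glue", the layer negative part of a real odd state, and the
closed form of the small-support coercivity constant. This file only DEFINES them and records the
diagonal identities; every analytic statement about them is proved in the sibling
`OddSectorOddOneSignedWindows*` files.

References: E. Bombieri, Rend. Lincei (9) 11 (2000) 183–233, Thm 2; S. Jarohs, T. Weth,
arXiv:1406.6181, Lemma 3.2 / Prop. 3.6 (the antisymmetric small-volume maximum principle whose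
algebra is transcribed here).
-/

noncomputable section

set_option linter.dupNamespace false

open Complex Filter Set MeasureTheory
open scoped Real Topology ComplexConjugate ArithmeticFunction.vonMangoldt

namespace Summit.RiemannHypothesis.RiemannHypothesis.Theorems.OddSector

open Literature.NumberTheory.LFunctions

/-- The **polar increment form** `D_t(f, h) = Re ∫ (f(x+t) − f(x)) conj(h(x+t) − h(x)) dx`, the
real polarisation of `weilIncrement` (`weilIncrement₂_self`). A real Bochner integral (junk value
`0` if the integrand is not integrable). [folklore] -/
def weilIncrement₂ (f h : ℝ → ℂ) (t : ℝ) : ℝ :=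
  ∫ x : ℝ, ((f (x + t) - f x) * conj (h (x + t) - h x)).re

/-- The **polar Dirichlet energy of the window `[-a, a]`**,
`𝓔_a(f, h) = Σ_{log n < 2a} Λ(n) n^{-1/2} D_{log n}(f, h) + ∫₀^∞ e^{t/2}/(2 sinh t) D_t(f, h) dt`,
the real polarisation of `weilDirichletEnergy a` (`weilDirichletEnergy₂_self`).
[cite: Bombieri2000Weil, Thm 2 (p. 193)] -/
def weilDirichletEnergy₂ (a : ℝ) (f h : ℝ → ℂ) : ℝ :=
  (∑ n ∈ weilPrimeIndex a, (Λ n : ℝ) / Real.sqrt n * weilIncrement₂ f h (Real.log n)) +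
    ∫ t in Ioi (0 : ℝ), weilArchDensity t * weilIncrement₂ f h t

/-- The **polar pole form** `P(f, h) = 2 Re[(∫ f cosh(t/2)) conj(∫ h cosh(t/2))]
− 2 Re[(∫ f sinh(t/2)) conj(∫ h sinh(t/2))]`, the real polarisation of `weilPoleForm`
(`weilPoleForm₂_self`; Yoshida's (6.2) in parity-free form). [cite: Yoshida1992, §6 eq. (6.2)] -/
def weilPoleForm₂ (f h : ℝ → ℂ) : ℝ :=
  2 * ((∫ t : ℝ, f t * (Real.cosh (t / 2) : ℂ)) * conj (∫ t : ℝ, h t * (Real.cosh (t / 2) : ℂ))).re -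
    2 * ((∫ t : ℝ, f t * (Real.sinh (t / 2) : ℂ)) * conj (∫ t : ℝ, h t * (Real.sinh (t / 2) : ℂ))).re

/-- The **prime defect on the origin layer**: for `0 < x < log 2`,
`D_u(x) = Σ_{log n < 2a} Λ(n) n^{-1/2} (u⁺(log n − x) − u⁺(log n + x))` (reflected atoms
`x + y = log n` minus direct atoms `y − x = log n` of the prime jump measure, seen from the layer
point `x`; `u⁺ = max (Re u) 0`). It vanishes identically at `x = 0`. [folklore] -/
def layerPrimeDefect (a : ℝ) (u : ℝ → ℂ) (x : ℝ) : ℝ :=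
  ∑ n ∈ weilPrimeIndex a, (Λ n : ℝ) / Real.sqrt n *
    (max ((u (Real.log n - x)).re) 0 - max ((u (Real.log n + x)).re) 0)

/-- The **archimedean glue seen from the layer**: for a layer point `x ∈ (0, η)`,
`G(x) = ∫_{η < y < a} Re u(y) · (k(|x − y|) − k(x + y)) dy`, `k = weilArchDensity` (antitone, so
the bracket is `≥ 0`); for every `x < η` the integrand is bounded, hence a genuine integral.
[folklore] -/
def layerArchGlue (a η : ℝ) (u : ℝ → ℂ) (x : ℝ) : ℝ :=
  ∫ y in Ioo η a, (u y).re * (weilArchDensity |x - y| - weilArchDensity (x + y))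

/-- The **layer negative part** `w = (Re u)⁻ · 𝟙_{(0, η)}` of a state `u`, as a complex-valued
function (real and `≥ 0`). [folklore] -/
def layerNegPart (η : ℝ) (u : ℝ → ℂ) (x : ℝ) : ℂ :=
  (((Ioo 0 η).indicator (fun y ↦ max (-(u y).re) 0) x : ℝ) : ℂ)

/-- The **small-support coercivity constant in closed form**,
`c₀(η) = π/2 − log 2 − log tanh(η/4) − 2 arctan(e^{η/2}) − (log 4π + γ)`; it equals
`2 ∫_η^∞ e^{t/2}/(2 sinh t) dt − 2 ∫₀^∞ (e^{t/2} − 1)/(2 sinh t) dt − (log 4π + γ)` (an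
antiderivative of `e^{t/2}/(2 sinh t)` is `½ log tanh(t/4) + arctan(e^{t/2})`), and
`c₀(η) = log(1/(2πη)) − γ + o(1)` as `η → 0⁺`; numerically `c₀(1/20) ≈ 0.556`, `c₀(1/50) ≈ 1.487`.
[folklore] -/
def layerCoercivityConst (η : ℝ) : ℝ :=
  π / 2 - Real.log 2 - Real.log (Real.tanh (η / 4)) - 2 * Real.arctan (Real.exp (η / 2)) -
    (Real.log (4 * π) + Real.eulerMascheroniConstant)

/-! ## Diagonal identities -/

/-- `Re (z conj z) = ‖z‖²`. [folklore] -/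
theorem re_mul_conj_self (z : ℂ) : (z * conj z).re = ‖z‖ ^ 2 := by
  rw [Complex.mul_conj, ← Complex.normSq_eq_norm_sq]
  simp

/-- On the diagonal the polar increment form is the increment form: `D_t(f, f) = D_t(f)`. [folklore] -/
theorem weilIncrement₂_self (f : ℝ → ℂ) (t : ℝ) : weilIncrement₂ f f t = weilIncrement f t := by
  unfold weilIncrement₂ weilIncrement
  congr 1 with x
  exact re_mul_conj_self _

/-- On the diagonal the polar energy is the Dirichlet energy: `𝓔_a(f, f) = 𝓔_a(f)`. [folklore] -/
theorem weilDirichletEnergy₂_self (a : ℝ) (f : ℝ → ℂ) :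
    weilDirichletEnergy₂ a f f = weilDirichletEnergy a f := by
  unfold weilDirichletEnergy₂ weilDirichletEnergy
  simp only [weilIncrement₂_self]

/-- On the diagonal the polar pole form is the pole form: `P(f, f) = P(f)`. [folklore] -/
theorem weilPoleForm₂_self (f : ℝ → ℂ) : weilPoleForm₂ f f = weilPoleForm f := by
  unfold weilPoleForm₂ weilPoleForm
  rw [re_mul_conj_self, re_mul_conj_self]

/-- The layer negative part is real-valued. [folklore] -/
theorem layerNegPart_im (η : ℝ) (u : ℝ → ℂ) (x : ℝ) : (layerNegPart η u x).im = 0 := by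
  simp [layerNegPart]

/-- The layer negative part is non-negative. [folklore] -/
theorem layerNegPart_re_nonneg (η : ℝ) (u : ℝ → ℂ) (x : ℝ) : 0 ≤ (layerNegPart η u x).re := by
  simp only [layerNegPart, Complex.ofReal_re]
  exact Set.indicator_nonneg (fun y _ ↦ le_max_right _ _) x

/-- Off the layer `(0, η)` the layer negative part vanishes. [folklore] -/
theorem layerNegPart_eq_zero_of_notMem {η : ℝ} {u : ℝ → ℂ} {x : ℝ} (hx : x ∉ Ioo 0 η) :
    layerNegPart η u x = 0 := by
  simp [layerNegPart, Set.indicator_of_notMem hx]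

/-- On the layer, `layerNegPart η u x = max (−Re u x) 0`. [folklore] -/
theorem layerNegPart_eq_of_mem {η : ℝ} {u : ℝ → ℂ} {x : ℝ} (hx : x ∈ Ioo 0 η) :
    layerNegPart η u x = ((max (-(u x).re) 0 : ℝ) : ℂ) := by
  simp [layerNegPart, Set.indicator_of_mem hx]

/-- Where the layer negative part is non-zero, `Re u < 0` and `w = −Re u`. [folklore] -/
theorem re_neg_of_layerNegPart_ne_zero {η : ℝ} {u : ℝ → ℂ} {x : ℝ} (hx : layerNegPart η u x ≠ 0) :
    x ∈ Ioo 0 η ∧ (u x).re < 0 ∧ layerNegPart η u x = ((-(u x).re : ℝ) : ℂ) := by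
  by_cases hm : x ∈ Ioo 0 η
  · rw [layerNegPart_eq_of_mem hm] at hx ⊢
    have h0 : max (-(u x).re) 0 ≠ 0 := fun h ↦ hx (by rw [h]; simp)
    have hneg : (u x).re < 0 := by
      by_contra hle
      exact h0 (max_eq_right (by linarith [not_lt.1 hle]))
    exact ⟨hm, hneg, by rw [max_eq_left (by linarith)]⟩
  · exact absurd (layerNegPart_eq_zero_of_notMem hm) hx

end Summit.RiemannHypothesis.RiemannHypothesis.Theorems.OddSector

end
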